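import Summits.QuantumFields.QCD.Theorems.GaussianLinkFramesFrameFMClosureTwoStarOfPaddedAux4
import Summits.QuantumFields.QCD.Theorems.GaussianLinkFramesFrameFMClosureTwoStarOfPaddedAux7

/-!
# Crux `GaussianLinkFrames.FrameFMClosure` (stmt-QuantumFields-17375), line `pad-the-fibre`, stub
`stub_twoStarOfPadded` — helper 8: the two-star package modulo the two REMAINING placement statements

Kernel-checked bookkeeping of where the stub `FibreBandLaw → PaddedCofactorDomination → SideWitness → ∀ N_f,
TwoStarBounds N_f` stands after helpers 1–7: `twoStarBounds_of_placements` derives `∀ N_f, TwoStarBounds N_f` from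
`FibreBandLaw`, `SideWitness` and three region statements —

* (U) dominated regions of `≤ 2064` links for `(univ, x, y)` on tori with `S ≥ 4` — PROVED from
  `PaddedCofactorDomination` (helper 6 `regionDom_univ_of_fullPadDom` + the skeleton-side ten-liner feeding it the
  `A = univ`, `M = ∅` instance; see the stub's work file);
* (A) dominated regions (some link budget `n₁`) for the depleted admissible sides `ebox`, `eboxᶜ`, `ballᶜ`, `S ≥ 4` —
  OPEN (pads clipped by the side: even clipped length, thin complements, `ballᶜ` corners);
* (C) the collar statement (some `n₂`): regions without links inside `W` or inside `Λᶜ` dominating the middle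
  factor — OPEN (pads with frozen boundary layers, re-balanced corners of `Λ`);

small tori `S ≤ 3` being covered for every admissible side by compactness (helper 7, `R = univ`, `≤ 9604` links).

References: Aizenman–Schenker–Friedrich–Hundertmark, CMP 224 (2001) 219, Lemmas 4–6 [AizenmanEtAl2001].
-/

noncomputable section

open scoped BigOperators
open MeasureTheory
open Literature.MathematicalPhysics.QuantumFieldTheory Literature.MathematicalPhysics.QuantumLattice
  Literature.Probability.LatticeModels
open Summit.QuantumFields.QCD.Theorems.VonMisesCircles Summit.QuantumFields.QCD.Theorems.VonMisesCirclesC1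

namespace Summit.QuantumFields.QCD.Theorems.PadTheFibreTwoStar

/-- Raising the constant of a `sup`-form domination inequality. [folklore] -/
theorem dom_mono {S : ℕ} {A : Finset (TorusSite 4 (2 * S + 1))} {m₀ C C' : ℝ} (hCC' : C ≤ C')
    {a b : TorusSite 4 (2 * S + 1)} {R : Finset (Edge 4 (2 * S + 1))}
    {U W : GaugeConfig 4 (2 * S + 1) (Matrix.specialUnitaryGroup (Fin 3) ℂ)}
    (h : blockNorm ((sideMatrix A (wilsonD (fun e => if e ∈ R then W e else U e) m₀)).adjugate) a b ≤
      C * ⨆ W' : GaugeConfig 4 (2 * S + 1) (Matrix.specialUnitaryGroup (Fin 3) ℂ),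
        ‖(sideMatrix A (wilsonD (fun e => if e ∈ R then W' e else U e) m₀)).det‖) :
    blockNorm ((sideMatrix A (wilsonD (fun e => if e ∈ R then W e else U e) m₀)).adjugate) a b ≤
      C' * ⨆ W' : GaugeConfig 4 (2 * S + 1) (Matrix.specialUnitaryGroup (Fin 3) ℂ),
        ‖(sideMatrix A (wilsonD (fun e => if e ∈ R then W' e else U e) m₀)).det‖ :=
  h.trans (mul_le_mul_of_nonneg_right hCC' (Real.iSup_nonneg fun _ => norm_nonneg _))

/-- **The two-star package from the three placement statements (U), (A), (C)** (see the module docstring),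
`FibreBandLaw` and `SideWitness`; small tori by compactness.  The stub `stub_twoStarOfPadded` is this theorem
with (U), (A), (C) discharged from `PaddedCofactorDomination` — (U) is (helper 6), (A) and (C) are not yet.
[cite: AizenmanEtAl2001, Lemmas 4–6] -/
theorem twoStarBounds_of_placements (hFBL : FibreBandLaw) (hSW : SideWitness)
    (hU : ∃ Cu : ℝ, 0 < Cu ∧ ∀ (m₀ : ℝ), -9 ≤ m₀ → m₀ ≤ 1 → ∀ (S : ℕ), 4 ≤ S →
      ∀ (x y : TorusSite 4 (2 * S + 1)),
      ∃ R : Finset (Edge 4 (2 * S + 1)), R.card ≤ 2064 ∧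
        ∀ U W : GaugeConfig 4 (2 * S + 1) (Matrix.specialUnitaryGroup (Fin 3) ℂ),
          blockNorm ((sideMatrix Finset.univ (wilsonD (fun e => if e ∈ R then W e else U e) m₀)).adjugate) x y ≤
            Cu * ⨆ W' : GaugeConfig 4 (2 * S + 1) (Matrix.specialUnitaryGroup (Fin 3) ℂ),
              ‖(sideMatrix Finset.univ (wilsonD (fun e => if e ∈ R then W' e else U e) m₀)).det‖)
    (hA : ∃ (n₁ : ℕ) (C₁ : ℝ), 0 < C₁ ∧ ∀ (m₀ : ℝ), -9 ≤ m₀ → m₀ ≤ 1 → ∀ (S : ℕ), 4 ≤ S →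
      ∀ (z : TorusSite 4 (2 * S + 1)) (r : ℕ), 1 ≤ r → r + 1 ≤ S →
      ∀ (A : Finset (TorusSite 4 (2 * S + 1))), (A = ebox S z r ∨ A = (ebox S z r)ᶜ ∨ A = (ball S z r)ᶜ) →
      ∀ (a b : TorusSite 4 (2 * S + 1)), a ∈ A → b ∈ A →
      ∃ R : Finset (Edge 4 (2 * S + 1)), R.card ≤ n₁ ∧
        ∀ U W : GaugeConfig 4 (2 * S + 1) (Matrix.specialUnitaryGroup (Fin 3) ℂ),
          blockNorm ((sideMatrix A (wilsonD (fun e => if e ∈ R then W e else U e) m₀)).adjugate) a b ≤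
            C₁ * ⨆ W' : GaugeConfig 4 (2 * S + 1) (Matrix.specialUnitaryGroup (Fin 3) ℂ),
              ‖(sideMatrix A (wilsonD (fun e => if e ∈ R then W' e else U e) m₀)).det‖)
    (hC : ∃ (n₂ : ℕ) (C₂ : ℝ), 0 < C₂ ∧ ∀ (m₀ : ℝ), -9 ≤ m₀ → m₀ ≤ 1 →
      ∀ (S : ℕ) (x : TorusSite 4 (2 * S + 1)) (ℓ : ℕ), 1 ≤ ℓ → 3 * ℓ + 4 ≤ S →
      ∀ (u' v : TorusSite 4 (2 * S + 1)),
        u' ∈ ebox S x (3 * ℓ + 2) → u' ∉ ebox S x ℓ → v ∈ ebox S x (3 * ℓ + 2) → v ∉ ebox S x ℓ →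
      ∃ R : Finset (Edge 4 (2 * S + 1)), R.card ≤ n₂ ∧
        (∀ e ∈ R, ¬(e.1 ∈ ebox S x ℓ ∧ Site.shift e.1 e.2 ∈ ebox S x ℓ)) ∧
        (∀ e ∈ R, ¬(e.1 ∈ (ebox S x (3 * ℓ + 2))ᶜ ∧ Site.shift e.1 e.2 ∈ (ebox S x (3 * ℓ + 2))ᶜ)) ∧
        ∀ U W : GaugeConfig 4 (2 * S + 1) (Matrix.specialUnitaryGroup (Fin 3) ℂ),
          blockNorm ((sideMatrix Finset.univ (wilsonD (fun e => if e ∈ R then W e else U e) m₀)).adjugate) u' v ≤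
            C₂ * ⨆ W' : GaugeConfig 4 (2 * S + 1) (Matrix.specialUnitaryGroup (Fin 3) ℂ),
              ‖(sideMatrix Finset.univ (wilsonD (fun e => if e ∈ R then W' e else U e) m₀)).det‖) :
    ∀ Nf : ℕ, TwoStarBounds Nf := by
  obtain ⟨Cu, hCu, hU⟩ := hU
  obtain ⟨n₁, C₁, hC₁, hA⟩ := hA
  obtain ⟨n₂, C₂, hC₂, hC⟩ := hC
  obtain ⟨Cs, hCs, hS⟩ := regionDom_small_of_sideWitness hSW 3
  set n : ℕ := max (max 2064 n₁) (max n₂ 9604) with hn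
  set C₀ : ℝ := max (max Cu C₁) (max C₂ Cs) with hC₀
  have hnu : 2064 ≤ n := (le_max_left _ _).trans (le_max_left _ _)
  have hn₁ : n₁ ≤ n := (le_max_right _ _).trans (le_max_left _ _)
  have hn₂ : n₂ ≤ n := (le_max_left _ _).trans (le_max_right _ _)
  have hns : 9604 ≤ n := (le_max_right _ _).trans (le_max_right _ _)
  have hcu : Cu ≤ C₀ := (le_max_left _ _).trans (le_max_left _ _)
  have hc₁ : C₁ ≤ C₀ := (le_max_right _ _).trans (le_max_left _ _)
  have hc₂ : C₂ ≤ C₀ := (le_max_left _ _).trans (le_max_right _ _)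
  have hcs : Cs ≤ C₀ := (le_max_right _ _).trans (le_max_right _ _)
  refine twoStarBounds_of_regionDomination hFBL hSW n C₀ (hCu.trans_le hcu) ?_ ?_
  · intro m₀ hm₁ hm₂ S A hAS a b ha hb
    by_cases hS4 : 4 ≤ S
    · rcases hAS with rfl | ⟨z, r, hr1, hrS, hA3⟩
      · obtain ⟨R, hR, h⟩ := hU m₀ hm₁ hm₂ S hS4 a b
        exact ⟨R, hR.trans hnu, fun U W => dom_mono hcu (h U W)⟩
      · obtain ⟨R, hR, h⟩ := hA m₀ hm₁ hm₂ S hS4 z r hr1 hrS A hA3 a b ha hb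
        exact ⟨R, hR.trans hn₁, fun U W => dom_mono hc₁ (h U W)⟩
    · have hS3 : S ≤ 3 := by omega
      refine ⟨Finset.univ, ?_, fun U W => dom_mono hcs (hS m₀ hm₁ hm₂ S hS3 A hAS a b U W)⟩
      rw [Finset.card_univ, Fintype.card_prod, Fintype.card_fin, Fintype.card_fun, ZMod.card, Fintype.card_fin]
      have h7 : 2 * S + 1 ≤ 7 := by omega
      calc (2 * S + 1) ^ 4 * 4 ≤ 7 ^ 4 * 4 := Nat.mul_le_mul_right _ (Nat.pow_le_pow_left h7 4)
        _ ≤ n := le_trans (by norm_num) hns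
  · intro m₀ hm₁ hm₂ S x ℓ hℓ hℓS u' v hu'Λ hu'W hvΛ hvW
    obtain ⟨R, hR, hRW, hRΛ, h⟩ := hC m₀ hm₁ hm₂ S x ℓ hℓ hℓS u' v hu'Λ hu'W hvΛ hvW
    exact ⟨R, hR.trans hn₂, hRW, hRΛ, fun U W => dom_mono hc₂ (h U W)⟩

/-- **Registered helper `stub_twoStarOfPadded_aux8` of crux stmt-QuantumFields-17375** (line `pad-the-fibre`, stub
`stub_twoStarOfPadded`): the two-star package from `FibreBandLaw`, `SideWitness` and the three placement statements
(U) [proved from `PaddedCofactorDomination`], (A), (C) [open] — one line; what remains of the stub is exactly (A) ∧ (C)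
from `PaddedCofactorDomination`. [cite: AizenmanEtAl2001, Lemmas 4–6] -/
theorem stub_twoStarOfPadded_aux8 : FibreBandLaw → SideWitness → (∃ Cu : ℝ, 0 < Cu ∧ ∀ (m₀ : ℝ), -9 ≤ m₀ → m₀ ≤ 1 → ∀ (S : ℕ), 4 ≤ S → ∀ (x y : TorusSite 4 (2 * S + 1)), ∃ R : Finset (Edge 4 (2 * S + 1)), R.card ≤ 2064 ∧ ∀ U W : GaugeConfig 4 (2 * S + 1) (Matrix.specialUnitaryGroup (Fin 3) ℂ), blockNorm ((sideMatrix Finset.univ (wilsonD (fun e => if e ∈ R then W e else U e) m₀)).adjugate) x y ≤ Cu * ⨆ W' : GaugeConfig 4 (2 * S + 1) (Matrix.specialUnitaryGroup (Fin 3) ℂ), ‖(sideMatrix Finset.univ (wilsonD (fun e => if e ∈ R then W' e else U e) m₀)).det‖) → (∃ (n₁ : ℕ) (C₁ : ℝ), 0 < C₁ ∧ ∀ (m₀ : ℝ), -9 ≤ m₀ → m₀ ≤ 1 → ∀ (S : ℕ), 4 ≤ S → ∀ (z : TorusSite 4 (2 * S + 1)) (r : ℕ), 1 ≤ r → r + 1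 ≤ S → ∀ (A : Finset (TorusSite 4 (2 * S + 1))), (A = ebox S z r ∨ A = (ebox S z r)ᶜ ∨ A = (ball S z r)ᶜ) → ∀ (a b : TorusSite 4 (2 * S + 1)), a ∈ A → b ∈ A → ∃ R : Finset (Edge 4 (2 * S + 1)), R.card ≤ n₁ ∧ ∀ U W : GaugeConfig 4 (2 * S + 1) (Matrix.specialUnitaryGroup (Fin 3) ℂ), blockNorm ((sideMatrix A (wilsonD (fun e => if e ∈ R then W e else U e) m₀)).adjugate) a b ≤ C₁ * ⨆ W' : GaugeConfig 4 (2 * S + 1) (Matrix.specialUnitaryGroup (Fin 3) ℂ), ‖(sideMatrix A (wilsonD (fun e => if e ∈ R then W' e else U e) m₀)).det‖) → (∃ (n₂ : ℕ) (C₂ : ℝ), 0 < C₂ ∧ ∀ (m₀ : ℝ), -9 ≤ m₀ → m₀ ≤ 1 → ∀ (S : ℕ) (x : TorusSite 4 (2 * S + 1)) (ℓ : ℕ), 1 ≤ ℓ → 3 * ℓ + 4 ≤ S → ∀ (u' v : TorusSite 4 (2 * S + 1)), u' ∈ ebox S x (3 * ℓ + 2) → u' ∉ ebox S x ℓ → v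 ∈ ebox S x (3 * ℓ + 2) → v ∉ ebox S x ℓ → ∃ R : Finset (Edge 4 (2 * S + 1)), R.card ≤ n₂ ∧ (∀ e ∈ R, ¬(e.1 ∈ ebox S x ℓ ∧ Site.shift e.1 e.2 ∈ ebox S x ℓ)) ∧ (∀ e ∈ R, ¬(e.1 ∈ (ebox S x (3 * ℓ + 2))ᶜ ∧ Site.shift e.1 e.2 ∈ (ebox S x (3 * ℓ + 2))ᶜ)) ∧ ∀ U W : GaugeConfig 4 (2 * S + 1) (Matrix.specialUnitaryGroup (Fin 3) ℂ), blockNorm ((sideMatrix Finset.univ (wilsonD (fun e => if e ∈ R then W e else U e) m₀)).adjugate) u' v ≤ C₂ * ⨆ W' : GaugeConfig 4 (2 * S + 1) (Matrix.specialUnitaryGroup (Fin 3) ℂ), ‖(sideMatrix Finset.univ (wilsonD (fun e => if e ∈ R then W' e else U e) m₀)).det‖) → ∀ Nf : ℕ, TwoStarBounds Nf :=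
  fun hFBL hSW hU hA hC => twoStarBounds_of_placements hFBL hSW hU hA hC

end Summit.QuantumFields.QCD.Theorems.PadTheFibreTwoStar
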